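import Summits.ResolutionOfSingularities.ResolutionOfSingularities.Theorems.EquisingularLiftEquisingularLiftNatDirLiftUnobsAssembly
import HarnessLib

/-!
# [OURS · L1 W4.5(b) · research residue `three_nonisolated_nonRatNoseTower`, brick D1] The genus-agnostic consumer clause from `DirStepUnobs`:
# the B3 assembly with `ℙ¹_A` replaced by any scheme `Y`

Cell `res-hironaka`, LADDER-RESOLUTION rung L (D-0089), slot W4.5(b), crux chain w45b: working crux
`Theses.EquisingularLift.EquisingularLiftNat` (stmt-ResolutionOfSingularities-20038) / child `EquisingularLiftNatThree`
(stmt-ResolutionOfSingularities-20148); research residue `stub_elnat_three_nonisolated_nonRatNoseTower` of CHILD skeleton v24, res-L1-w45b-stub-4's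
RESIDUE-2 census (`L/res-L1-w45b-stub-4/RESIDUE2-CENSUS.md` 598f05d6100306f2, sigs `RESIDUE2-pieces.sig.lean` 1b9598fbe85947fc), brick **D1**,
dealt BY SIGNATURE to res-L1-w45b-stub-2 g9 (desk STATUS l.78051). `--supports stmt-ResolutionOfSingularities-20148 --as helper`. OURS; NOT a
statement of any manuscript; AI-written, and AI review is weaker than expert review. No `sorry`, standard axioms, DEF-FREE.

WHAT. **`subsingleton_cechMH1_sheafHom_of_dirStepUnobs_any`** — res-L1-w45b-lead-2's B3 assembly `subsingleton_cechMH1_sheafHom_Dplus_of_dirStepUnobs`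
(p591369) with the rational carrier `ℙ¹_A` replaced by ANY scheme `Y ≅ Γ̃₁` (the (R2-a) stratum of the census: the exceptional ruled surface lives
over a carrier curve of positive genus): from `hunobs : DirStepUnobs G E hE Z hZ` on the stage, the isomorphisms `ε`, `εZ` to the root round, a
closed immersion `i₁ : Γ̃₁ ⟶ Ẽ₁` with conormal LINE bundle, `Φ : Y ≅ Γ̃₁`, a short exact `0 → L₀ → F → Q → 0` on `Y` (`rk L₀ = 1`, `rk F = 2`)
and the bridge identity (★) `Φ^*[𝒞]·[F] = [L₀]²`, the CONSUMER clause holds on `Y` in `DirStepUnobs` shape: `Ȟ¹(V; 𝓗om(L₀, Q)) = 0` on SOME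
affine two-cover `V` of `Y` with affine overlap — namely the `DirStepUnobs` cover transported along `Φ`. No `Pic ℙ¹` step and no cover
independence: B0 `dirStepUnobs_transport` ⇒ `Ȟ¹(V; 𝒩) = 0` on `Γ̃₁`; `[𝒩] = [𝒞]⁻¹`, `[𝓗om(L₀,Q)] = [F]·[L₀]⁻²`, (★) ⇒ `Φ^*[𝒩] = [𝓗om(L₀,Q)]`
(`cechPic_pullback_eq_of_bridge`); equal rank-one classes ⇒ `Φ^*𝒩 ≅ 𝓗om(L₀,Q)` (`nonempty_iso_of_cocycle_equiv`, `detClass_pullback`);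
`Ȟ¹ = 0` moves along `Φ` and the module iso (B0's `subsingleton_cechMH1_of_schemeIso` / `_iff_of_base`, `subsingleton_cechMH1_of_iso`).

References (index only): R. Hartshorne, *Algebraic Geometry* (1977), III Ex. 4.5, II Ex. 6.8 [cite: Hartshorne1977]; The Stacks Project,
Tag 01ED [cite: StacksProject].
-/

noncomputable section

-- `TopCat.Presheaf`/`Scheme.Modules` are not reducible (as in Mathlib's `AlgebraicGeometry/Modules`).
set_option backward.isDefEq.respectTransparency false

open CategoryTheory CategoryTheory.Limits AlgebraicGeometry TopologicalSpace Opposite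
open Literature.AlgebraicGeometry.Modules Literature.AlgebraicGeometry.Motives
open Literature.AlgebraicGeometry.Morphisms (CechMH1 ProjCech.PP ProjCech.toSpec ProjCech.Dplus preimageFamily)
open Literature.AlgebraicGeometry.Deformation (conormalSheaf idealModule)
open Literature.AlgebraicGeometry.HodgeTheory (normalSheaf IsRegularImmersionOfCodim)

set_option linter.dupNamespace false -- mandated namespace `Summit.<Summit>.<Problem>` of this single-conjunct summit

namespace Summit.ResolutionOfSingularities.ResolutionOfSingularities.Cruxes.EquisingularLiftNat.Sections

/-- **D1 — the genus-agnostic consumer clause from `DirStepUnobs`** (the B3 assembly with `ℙ¹_A ↦ Y`): conclusion = `Ȟ¹(V; 𝓗om(L₀, Q)) = 0` on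
the `DirStepUnobs` two-cover transported along `Φ : Y ≅ Γ̃₁` (affine pieces, affine overlap, covering). [cite: Hartshorne1977, III Ex. 4.5] -/
theorem subsingleton_cechMH1_sheafHom_of_dirStepUnobs_any {Y : Scheme.{0}}
    -- the stage `(G ⊇ E ⊇ Z)` and the root round `(G₁ ⊇ E₁ ⊇ Γ₁)` with the isomorphisms `ε`, `εZ` (B0's binders verbatim)
    (G : Scheme.{0}) (E : Set G) (hE : IsClosed E) (Z : Set G) (hZ : IsClosed Z)
    (G₁ : Scheme.{0}) (ϱ : G ⟶ G₁) (E₁ : Set G₁) (hE₁ : IsClosed E₁) (Γ₁ : Set G₁) (hΓ₁ : IsClosed Γ₁)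
    (ε : redSub G E hE ⟶ redSub G₁ E₁ hE₁) (εZ : redSub G Z hZ ⟶ redSub G₁ Γ₁ hΓ₁)
    (hZE : Z ⊆ E) (hΓE : Γ₁ ⊆ E₁)
    (hεiso : IsIso ε) (hεcomm : ε ≫ redSubι G₁ E₁ hE₁ = redSubι G E hE ≫ ϱ)
    (hεZiso : IsIso εZ) (hεZcomm : εZ ≫ redSubι G₁ Γ₁ hΓ₁ = redSubι G Z hZ ≫ ϱ)
    (hunobs : DirStepUnobs G E hE Z hZ)
    -- the closed immersion `i₁ : Γ̃₁ ⟶ Ẽ₁` over `G₁` and its conormal LINE bundle (B1b/B1c frames)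
    (i₁ : redSub G₁ Γ₁ hΓ₁ ⟶ redSub G₁ E₁ hE₁) (hi₁ : i₁ ≫ redSubι G₁ E₁ hE₁ = redSubι G₁ Γ₁ hΓ₁)
    (h𝒞f : IsFiniteLocallyFree (conormalSheaf i₁)) (h𝒞1 : HasRank (conormalSheaf i₁) 1)
    -- the identification `Φ : ℙ¹_A ≅ Γ̃₁` (plumbing `exists_iso_redSub_of_subscheme_eq`)
    (Φ : Y ≅ redSub G₁ Γ₁ hΓ₁)
    -- the `Q`-side: `0 → L₀ → F → Q → 0` on `ℙ¹_A`
    {S : ShortComplex Y.Modules} (hS : S.ShortExact)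
    (hL₀f : IsFiniteLocallyFree S.X₁) (hL₀1 : HasRank S.X₁ 1)
    (hFf : IsFiniteLocallyFree S.X₂) (hF2 : HasRank S.X₂ 2) (hQf : IsFiniteLocallyFree S.X₃)
    -- (★) res-type-027's bridge `cechPic_pullback_detClass_conormal_section`, taken by name as a hypothesis
    (hstar : CechPic.pullback Φ.hom (detClass h𝒞f) * detClass hFf = detClass hL₀f ^ 2) :
    ∃ V : Fin 2 → Y.Opens, (∀ j, IsAffineOpen (V j)) ∧ IsAffineOpen (V 0 ⊓ V 1) ∧ ⨆ j, V j = ⊤ ∧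
      Subsingleton (CechMH1 Y.toSpecΓ (sheafHom S.X₁ S.X₃) V) := by
  -- B0: the unobstructedness datum on the root round, for THIS `i₁`
  have hunobs₁ : DirStepUnobs G₁ E₁ hE₁ Γ₁ hΓ₁ :=
    dirStepUnobs_transport G E hE Z hZ G₁ ϱ E₁ hE₁ Γ₁ hΓ₁ ε εZ hZE hΓE hεiso hεcomm hεZiso hεZcomm hunobs
  obtain ⟨V, hVaff, hV01, hVtop, hN⟩ := hunobs₁ i₁ hi₁
  -- the normal LINE bundle `𝒩 = 𝒞^∨` and its class `[𝒩] = [𝒞]⁻¹`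
  have hNf : IsFiniteLocallyFree (normalSheaf i₁) := isFiniteLocallyFree_dual_of_hasRank_one h𝒞1
  obtain ⟨hN1, hNcl⟩ := detClass_dual_eq_inv h𝒞1 h𝒞f hNf
  -- the `Q`-side: `rk Q = 1`, `𝓗om(L₀, Q)` is a line bundle of class `[F]·[L₀]⁻²`
  have hQ1 : HasRank S.X₃ 1 := hasRank_X₃_one_of_shortExact hS hL₀1 hF2 hQf
  have hHf : IsFiniteLocallyFree (sheafHom S.X₁ S.X₃) := isFiniteLocallyFree_sheafHom_of_hasRank_one hL₀1 hQ1
  have hH1 : HasRank (sheafHom S.X₁ S.X₃) 1 := hasRank_sheafHom_one_of_shortExact hL₀1 hQ1 hL₀f hQf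
  have hHcl : detClass hHf = detClass hFf * (detClass hL₀f ^ 2)⁻¹ :=
    detClass_sheafHom_eq_of_shortExact hS hL₀1 hQ1 hL₀f hFf hQf hHf
  -- (★) ⇒ `Φ^*[𝒩] = [𝓗om(L₀, Q)]`
  have hcl : CechPic.pullback Φ.hom (detClass hNf) = detClass hHf :=
    cechPic_pullback_eq_of_bridge Φ.hom (detClass h𝒞f) (detClass hNf) (detClass hFf) (detClass hL₀f) (detClass hHf)
      hstar hNcl hHcl
  -- equal rank-one classes on `Y` ⇒ `Φ^* 𝒩 ≅ 𝓗om(L₀, Q)`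
  obtain ⟨FN, hFN⟩ := exists_frameSystem_of_hasRank hN1
  obtain ⟨FH, hFH⟩ := exists_frameSystem_of_hasRank hH1
  have hcl' : CechPic.mk (FN.pullback Φ.hom).cocycle = CechPic.mk FH.cocycle := by
    rw [← detClass_eq_mk (hNf.pullback Φ.hom) (FN.pullback Φ.hom), detClass_pullback Φ.hom hNf, hcl, detClass_eq_mk hHf FH]
  obtain ⟨e⟩ := nonempty_iso_of_cocycle_equiv (FN.pullback Φ.hom) FH (fun x => hFN _) hFH hcl'
  -- `Ȟ¹ = 0` for `Φ^* 𝒩` on the transported cover (any structure map), then for `𝓗om(L₀, Q)`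
  have e' : (Scheme.Modules.pushforward Φ.symm.inv).obj ((Scheme.Modules.pullback Φ.hom).obj (normalSheaf i₁)) ≅ normalSheaf i₁ :=
    (Scheme.Modules.pushforward Φ.hom).mapIso (pullbackInvIsoPushforward Φ.symm (normalSheaf i₁)) ≪≫
      (isoPushforwardInvPushforward Φ.symm (normalSheaf i₁)).symm
  have h₁ : Subsingleton (CechMH1 (Φ.hom ≫ (redSub G₁ Γ₁ hΓ₁).toSpecΓ) ((Scheme.Modules.pullback Φ.hom).obj (normalSheaf i₁))
      (preimageFamily Φ.hom V)) :=
    subsingleton_cechMH1_of_schemeIso (redSub G₁ Γ₁ hΓ₁).toSpecΓ (normalSheaf i₁) V Φ.symm (Φ.hom ≫ (redSub G₁ Γ₁ hΓ₁).toSpecΓ) rfl e' hN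
  have h₂ : Subsingleton (CechMH1 Y.toSpecΓ ((Scheme.Modules.pullback Φ.hom).obj (normalSheaf i₁)) (preimageFamily Φ.hom V)) :=
    (subsingleton_cechMH1_iff_of_base _ _ _ _).mp h₁
  have h₃ : Subsingleton (CechMH1 Y.toSpecΓ (sheafHom S.X₁ S.X₃) (preimageFamily Φ.hom V)) :=
    subsingleton_cechMH1_of_iso _ _ e.symm h₂
  exact ⟨preimageFamily Φ.hom V, fun j => (hVaff j).preimage_of_isIso Φ.hom, hV01.preimage_of_isIso Φ.hom,
    Φ.hom.iSup_preimage_eq_top hVtop, h₃⟩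

end Summit.ResolutionOfSingularities.ResolutionOfSingularities.Cruxes.EquisingularLiftNat.Sections

end
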